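import Summits.CriticalPhenomena.SAWScalingLimit.Theorems.SAWLeftRightFKGFKGToTraversalBoundSlitNecklacePieces
import HarnessLib

/-!
# Window shadow: transfer of separated index windows along a monotone trace
(crux `SAWLeftRightFKG.FKGToTraversalBound`, stmt-CriticalPhenomena-1878; line `slit-necklace`,
witness unit U3', plumbing helper of the registered stub `stub_necklaceWitnessFarU`)

A HUGGING RUN of the planar witness is a walk `q` whose `n`-th vertex is embedded within `ε₀` of the
vertex `p.getVert (φ n)` of the hugged lattice path `p`, for a MONOTONE (non-strict, with forward
jumps) index trace `φ : ℕ → ℕ`.  This file transfers `2k` strictly separated index windows of `q`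
across the shell `D(y; σ₁, σ₂)` to `k` strictly separated index windows of `p` inside
`[φ 0, φ q.length]` across the `ε₀`-thinner shell `D(y; σ₁ + ε₀, σ₂ - ε₀)`: take every other window
of `q` and push it forward by `φ`.  The factor `2` is lost because non-strict monotonicity of `φ` may
merge the end of one window of `q` with the start of the next one; it cannot merge across a whole
intermediate window, whose two ends are shadowed on opposite sides of the thinner shell
(`σ₁ + ε₀ < σ₂ - ε₀`).  Pure index bookkeeping plus the triangle inequality; no literature fact.
-/

noncomputable section

open MeasureTheory Filter Topology Set Metric
open scoped NNReal ENNReal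
open Literature.Probability.LatticeModels
open Literature.Probability.RandomPlanarGeometry
open Literature.Probability.RandomPlanarGeometry.SAW

namespace Summit.CriticalPhenomena.SAWScalingLimit.Theorems.FKGToTraversalBound.SlitNecklace

/-- **Window shadow along a monotone trace.**  Let `q` hug `p` along the monotone index trace `φ`
with precision `ε₀`: `dist (emb' (q.getVert n)) (emb (p.getVert (φ n))) ≤ ε₀` for `n ≤ q.length`.
If `σ₁ + ε₀ < σ₂ - ε₀`, then `2k` strictly separated index windows of `q` (inside `[0, q.length]`)
across `D(y; σ₁, σ₂)` yield `k` strictly separated index windows of `p` inside `[φ 0, φ q.length]`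
across `D(y; σ₁ + ε₀, σ₂ - ε₀)`: the images under `φ` of every other window of `q`. [folklore] -/
theorem hasSepWindows_of_monotone_shadow : ∀ {V V' E : Type*} [PseudoMetricSpace E]
    {G : SimpleGraph V} {G' : SimpleGraph V'} {u v : V} {u' v' : V'} (emb : V → E) (emb' : V' → E)
    (p : G.Walk u v) (q : G'.Walk u' v') (φ : ℕ → ℕ) (k : ℕ) (y : E) (σ₁ σ₂ ε₀ : ℝ),
    Monotone φ → φ q.length ≤ p.length →
    (∀ n, n ≤ q.length → dist (emb' (q.getVert n)) (emb (p.getVert (φ n))) ≤ ε₀) →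
    σ₁ + ε₀ < σ₂ - ε₀ → HasSepWindows emb' q (2 * k) 0 q.length y σ₁ σ₂ →
    HasSepWindows emb p k (φ 0) (φ q.length) y (σ₁ + ε₀) (σ₂ - ε₀) := by
  intro V V' E _ G G' u v u' v' emb emb' p q φ k y σ₁ σ₂ ε₀ hφ _hlen hshadow hthin hW
  obtain ⟨a, b, hab, hside, hsep⟩ := hW
  -- the shadow `p.getVert (φ n)` of `q.getVert n` is at almost the same distance from `y`
  have hnear : ∀ n, n ≤ q.length →
      dist (emb (p.getVert (φ n))) y ≤ dist (emb' (q.getVert n)) y + ε₀ ∧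
        dist (emb' (q.getVert n)) y ≤ dist (emb (p.getVert (φ n))) y + ε₀ := by
    intro n hn
    have h := hshadow n hn
    have h1 := dist_triangle_left (emb (p.getVert (φ n))) y (emb' (q.getVert n))
    have h2 := dist_triangle (emb' (q.getVert n)) (emb (p.getVert (φ n))) y
    constructor <;> linarith
  -- every other window of `q`: the even-numbered ones (`e`) are kept, the odd ones (`e'`) separate them
  obtain ⟨e, he⟩ : ∃ e : Fin k → Fin (2 * k), ∀ m, (e m : ℕ) = 2 * m :=
    ⟨fun m => ⟨2 * m, by have := m.2; omega⟩, fun m => rfl⟩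
  obtain ⟨e', he'⟩ : ∃ e' : Fin k → Fin (2 * k), ∀ m, (e' m : ℕ) = 2 * m + 1 :=
    ⟨fun m => ⟨2 * m + 1, by have := m.2; omega⟩, fun m => rfl⟩
  refine ⟨fun m => φ (a (e m)), fun m => φ (b (e m)), fun m => ?_, fun m => ?_,
    fun m m' hmm' => ?_⟩
  · -- range: `φ 0 ≤ φ (a _) ≤ φ (b _) ≤ φ q.length` by monotonicity
    show φ 0 ≤ φ (a (e m)) ∧ φ (a (e m)) ≤ φ (b (e m)) ∧ φ (b (e m)) ≤ φ q.length
    exact ⟨hφ (Nat.zero_le _), hφ (hab (e m)).2.1, hφ (hab (e m)).2.2⟩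
  · -- sides: the shadows of the two ends lie on opposite sides of the thinner shell
    show (dist (emb (p.getVert (φ (a (e m))))) y ≤ σ₁ + ε₀ ∧
        σ₂ - ε₀ ≤ dist (emb (p.getVert (φ (b (e m))))) y) ∨
      (σ₂ - ε₀ ≤ dist (emb (p.getVert (φ (a (e m))))) y ∧
        dist (emb (p.getVert (φ (b (e m))))) y ≤ σ₁ + ε₀)
    have hA := hnear (a (e m)) ((hab (e m)).2.1.trans (hab (e m)).2.2)
    have hB := hnear (b (e m)) (hab (e m)).2.2
    rcases hside (e m) with ⟨h1, h2⟩ | ⟨h1, h2⟩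
    · exact Or.inl ⟨by linarith [hA.1], by linarith [hB.2]⟩
    · exact Or.inr ⟨by linarith [hA.2], by linarith [hB.1]⟩
  · -- strict separation: `φ` cannot be constant across the whole intermediate window `e' m`
    show φ (b (e m)) < φ (a (e m'))
    have h12 : e m < e' m := Fin.lt_def.2 (by rw [he, he']; omega)
    have h23 : e' m < e m' :=
      Fin.lt_def.2 (by rw [he', he]; have := Fin.lt_def.1 hmm'; omega)
    have hab' := hab (e' m)
    have c1 : φ (b (e m)) ≤ φ (a (e' m)) := hφ (hsep h12).le
    have c2 : φ (a (e' m)) ≤ φ (b (e' m)) := hφ hab'.2.1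
    have c3 : φ (b (e' m)) ≤ φ (a (e m')) := hφ (hsep h23).le
    by_contra hnot
    have heq : φ (a (e' m)) = φ (b (e' m)) := by omega
    have hA := hnear (a (e' m)) (hab'.2.1.trans hab'.2.2)
    have hB := hnear (b (e' m)) hab'.2.2
    rw [heq] at hA
    rcases hside (e' m) with ⟨h1, h2⟩ | ⟨h1, h2⟩
    · linarith [hA.1, hB.2]
    · linarith [hA.2, hB.1]

end Summit.CriticalPhenomena.SAWScalingLimit.Theorems.FKGToTraversalBound.SlitNecklace
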